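import Literature.Geometry.Kaehler.ComplexTorusHodgeGroupHodgeCircleComplexPoints
import Literature.Geometry.Kaehler.ComplexTorusHodgeGroupHodgeCircleSigmaPiHomClasses
import Literature.Geometry.Kaehler.ComplexTorusLefschetzGroupSigmaPi
import Literature.Geometry.Kaehler.ComplexTorusHodgeGroupProductCMEllipticCurves
import Literature.Geometry.Kaehler.ComplexTorusMumfordTateGroupMaximalTorus
import HarnessLib

/-!
# The COMPLEX points of the Hodge group of an arbitrary finite product `∏ₖ X_k` of complex tori on the Hodge-circle
# locus: `Hg(∏ₖ X_k)(ℂ) = {diag_k(ν_k(u_{d(k)})) : u ∈ (ℂ^×)^R}`, one complex parameter per `Hom`-class — the split torus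
# `𝔾_m(ℂ)^R` complexifying the class-diagonal `U(1)^R` of the real points (Imai 1976 §3 Remarks «the diagonal
# `Δ_{m_i}`»; Moonen–Zarhin 1999 §1, §3 Corollary; Deligne 1982 I §5)

Layer `Literature/Geometry/Kaehler`, namespace `Literature.Geometry.Kaehler.ComplexTorus`; lane `lit-hodgefound`
(Track 2 foundations library), Layer A3/A4 (Hodge groups; CM abelian varieties); prover seat `lit-hodgefound-p17`
(generation 35, self-proposed row g35-#4 = FREE POINTER (σ) of the gen-34 HANDOFF: the complex points of `Hg` of PRODUCTS
of locus tori). Sequel, BY NAME and without restating anything, of g35-#1 `ComplexTorusHodgeGroupHodgeCircleSigmaPiHomClasses`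
(the REAL points with a `Hom`-colouring `d`: `sigmaBlockDiagSL_hodgeCircleSL_comp_mem_hodgeGroup_sigmaPiPeriod`,
`exists_homColouring_of_coe_eq_range`), of g35-#3 `ComplexTorusHodgeGroupHodgeCircleComplexPoints` (one locus torus:
`mem_hodgeGroupC_iff_exists_complexCircleHom_of_coe_hodgeGroup_eq_range`), of p06's `ComplexTorusHodgeGroupSigmaPi`
(`sigmaBlockDiagSL σ ℂ`, `exists_eq_sigmaBlockDiagSL_of_mem_hodgeGroupC_sigmaPi`, `jMatrix_sigmaPiPeriod`), of
`ComplexTorusLefschetzGroupSigmaPi` (Gordon's one-block endomorphisms `sigmaBlockSingle`, `sigmaBlockSingle_mem_endAlgRat_sigmaPi`,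
the block calculus `sigmaBlock_…`), of `ComplexTorusHodgeGroupProductCMEllipticCurves` (the Laurent-curve density
`mem_ratZeroLocus_of_infinite`, `infinite_range_natCast_add_div`), of `ComplexTorusHodgeGroup` (`centralizerEqs`,
`hodgeCircle_mem_ratZeroLocus_centralizerEqs`: `Hg` centralises `End_ℚ`), of `ComplexTorusHodgeGroupProductNonCMEllipticCurve`
(`complexCircle_eq_smul_add_smul`, `complexCircle_exp_mul_I`) and of p22's `ComplexTorusMumfordTateGroupMaximalTorus`
(`hodgeSC_sub_hodgeSC`). THEOREMS ONLY (no definition, no instance, no named fact; D-0026 net debt 0).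

## The argument

`⊇` (DENSITY, §2–§3): for a `Hom`-class `i` the class-partial complex circle `G_i(u) = diag_k(ν_k(u) if d(k) = i, else 1)`
is a Laurent curve `A₀ + uA₁ + u⁻¹A₂` in `SL(V_ℂ)` whose values at `|u| = 1` are the REAL points
`diag_k(h_k(e^{iθ}) if d(k) = i, else 1) ∈ Hg(∏ₖ X_k)(ℝ)` of g35-#1 (angles `θ·𝟙_{i}` constant on classes); a rational
polynomial vanishing on `h(S¹)` vanishes on `Hg(ℝ)`, hence at `G_i(u)` for the infinitely many `u` of modulus one, hence
at every `u ∈ ℂ^×` (`mem_ratZeroLocus_of_infinite`): `G_i(u) ∈ Hg(∏ₖ X_k)(ℂ)`, and `diag_k(ν_k(u_{d(k)})) = ∏_i G_i(u_i)`.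
`⊆` (§4): `Hg(∏ₖ X_k)(ℂ) ⊆ ∏ₖ Hg(X_k)(ℂ) = ∏ₖ ν_k(ℂ^×)` (p06 + g35-#3), so `M = diag_k(ν_k(v_k))`; for `Hom_ℚ(X_k, X_l) ∋ f ≠ 0`
Gordon's one-block endomorphism `S_{lk}(f) ∈ End_ℚ(∏ X)` is centralised by `Hg(ℂ)` (Lange Prop. 7.2.5), whence
`ν_l(v_l) f = f ν_k(v_k) = ν_l(v_k) f`, i.e. `(ν_l(w) − 1) f = 0` with `w = v_l / v_k`; but `ν_l(w) − 1 = h_ℂ(w − 1, w⁻¹ − 1)`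
is invertible for `w ≠ 1`, so `v_k = v_l`: the parameters are CONSTANT ON `Hom`-CLASSES.

## Sources, verbatim

* H. Imai, *On the Hodge groups of some abelian varieties*, Kōdai Math. Sem. Rep. 27 (1976), §3 Remarks (p. 370 L31–L38):
  "if `A` is isogenous to `E₁^{m₁} × ⋯ × E_k^{m_k}` where `E_i` are elliptic curves of CM-type and `E_i` and `E_j` are not
  isogenous for `i ≠ j`, then `Hg(A) = Δ_{m₁}(Hg(E₁)) × ⋯ × Δ_{m_k}(Hg(E_k))` where `Δ_m` denotes the diagonal"; §2
  (p. 368 L5–L7): "`Hg(E)` is a 1-dimensional torus if `E` is of CM-type".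
* B. Moonen, Yu. G. Zarhin, *Hodge classes on abelian varieties of low dimension*, Math. Ann. 315 (1999), §1 (held
  `paper:arxiv-math_9901113`, p0002 L138–L141): "For `n ≥ 1` we can identify `Hg(Xⁿ)` with `Hg(X)`, acting diagonally";
  (p0002): "`Hg(X₁ × X₂) ⊂ Hg(X₁) × Hg(X₂)` and the two projections are surjective"; §2 (2.2) "Type IV(1,1): … `Hg(X) = U_F`";
  §3 Corollary (p0007 L80–L85).
* P. Deligne, *Hodge cycles on abelian varieties* (LNM 900, 1982), I §5 (p. 63): "`G_ℂ` is generated by the groups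
  `{σμ(𝔾_m) | σ ∈ Aut(ℂ)}`"; "`A` is of CM-type if and only if each `A_α` is".
* H. Lange, *Abelian Varieties over the Complex Numbers* (2023), §7.2.1 Remark 7.2.2 (1) (p. 329) (the conjugates `h(S¹)^σ`
  in `SL(V_ℂ)`); §7.2.2 Prop. 7.2.5 ("the centralizer `G` of `End_ℚ(X)` … is defined over `ℚ` … `Hg(X) ⊆ G`").
* B. B. Gordon, *A survey of the Hodge conjecture for abelian varieties* (1997), 2.15 Lemma (proof: "`W = H₁(A, ℚ) ≃ ⊕ H₁(A_i, ℚ)`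
  … must preserve each `H₁(A_i, ℚ)`"); §3 Theorem.

## What is proved (`ν_k = complexCircleHom (Ψ k)`, `d : κ → R` a `Hom`-colouring: `d k = d l ⟺ Hom_ℚ(X_k, X_l) ≠ 0`)

* §1 (ANY family): `complexCircle_sigmaPiPeriod`, `complexCircleHom_sigmaPiPeriod` (`ν_∏(u) = diag_k(ν_k(u))`),
  `sigmaBlockDiagSL_complexCircleHom_const_mem_hodgeGroupC_sigmaPiPeriod`.
* §2 DENSITY (ANY family, any decidable `p ⊆ κ`): **`sigmaBlockDiagSL_ite_complexCircleSL_mem_hodgeGroupC_sigmaPiPeriod`**: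
  if the partial real circles `diag_k(h_k(e^{iθ}) if p k else 1)` lie in `Hg(∏ₖ X_k)(ℝ)` for all `θ`, the partial complex
  circles `diag_k(ν_k(u) if p k else 1)` lie in `Hg(∏ₖ X_k)(ℂ)` for all `u ∈ ℂ^×` (`…complexCircleHom…` form too).
* §3 ON THE LOCUS, `⊇`: **`sigmaBlockDiagSL_complexCircleHom_comp_mem_hodgeGroupC_sigmaPiPeriod`**:
  `diag_k(ν_k(u_{d(k)})) ∈ Hg(∏ₖ X_k)(ℂ)` for every `u : R → ℂ^×`.
* §4 ON THE LOCUS, `⊆`: **`complexCircleHom_apply_eq_of_sigmaBlockDiagSL_mem_hodgeGroupC_sigmaPiPeriod`**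
  (`diag_k(ν_k(v_k)) ∈ Hg(ℂ)`, `Hom_ℚ(X_k, X_l) ≠ 0` ⟹ `v_k = v_l`), and THE DESCRIPTION
  **`mem_hodgeGroupC_sigmaPiPeriod_iff_exists_of_homColouring`: `M ∈ Hg(∏ₖ X_k)(ℂ) ⟺ M = diag_k(ν_k(u_{d(k)}))`, `u ∈ (ℂ^×)^R`**;
  `coe_hodgeGroupC_sigmaPiPeriod_eq_range_of_homColouring`; colouring-free **`mem_hodgeGroupC_sigmaPiPeriod_iff_exists_of_coe_eq_range`**
  (`M = diag_k(ν_k(v_k))` with `v_k = v_l` whenever `Hom ≠ 0`) and **`sigmaBlockDiagSL_complexCircleHom_mem_hodgeGroupC_sigmaPiPeriod_iff`**.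

## References

* [Imai1976HodgeGroups] H. Imai, Kōdai Math. Sem. Rep. 27 (1976), §2 (p. 368), §3 Remarks (p. 370).
* [MoonenZarhin1999LowDim] B. Moonen, Yu. Zarhin, Math. Ann. 315 (1999), §1, §2 (2.2), §3 Corollary.
* [Deligne1982HodgeCycles] P. Deligne, LNM 900 (1982), I §3, I §5.
* [Lange2023AbelianVarietiesComplex] H. Lange (2023), §7.2.1 Remark 7.2.2 (1), §7.2.2 Prop. 7.2.5.
* [Gordon1997] B. B. Gordon (1997), 2.15 Lemma, §3 Theorem.
-/

noncomputable section

open scoped Real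
open Complex Module Matrix Function

namespace Literature.Geometry.Kaehler

namespace ComplexTorus

/-! ## §1 The complexified circle of a product is block-diagonal -/

section Blocks

variable {κ : Type*} [Fintype κ] [DecidableEq κ] {σ : κ → Type*} [∀ k, Fintype (σ k)] [∀ k, DecidableEq (σ k)]
  {F : κ → Type*} [∀ k, NormedAddCommGroup (F k)] [∀ k, NormedSpace ℂ (F k)]
  (Ψ : ∀ k, (σ k → ℝ) ≃L[ℝ] F k)

/-- **`ν_∏(u) = diag_k(ν_k(u))`**: the complexified circle of `∏ₖ X_k` is block-diagonal (`J_∏ = diag(J_k)`).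
[cite: MoonenZarhin1999LowDim, §1 (p0002 L138–L141: "acting diagonally")] [cite: Deligne1982HodgeCycles, I §5] -/
theorem complexCircle_sigmaPiPeriod (u : ℂ) :
    complexCircle (sigmaPiPeriod Ψ) u = Matrix.blockDiagonal' fun k ↦ complexCircle (Ψ k) u := by
  have hfun : (fun k ↦ complexCircle (Ψ k) u) = ((u + u⁻¹) / 2) • (1 : ∀ k, Matrix (σ k) (σ k) ℂ) +
      ((u - u⁻¹) / (2 * I)) • fun k ↦ (jMatrix (Ψ k)).map Complex.ofRealHom := by
    funext k; rfl
  rw [complexCircle, jMatrix_sigmaPiPeriod, Matrix.blockDiagonal'_map _ _ (map_zero _), hfun, Matrix.blockDiagonal'_add,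
    Matrix.blockDiagonal'_smul, Matrix.blockDiagonal'_smul, Matrix.blockDiagonal'_one]

/-- `ν_∏(u) = sigmaBlockDiagSL (ν_k(u))_k` in `SL(V_ℂ)`. [cite: MoonenZarhin1999LowDim, §1 (p0002 L138–L141)] -/
theorem complexCircleHom_sigmaPiPeriod (u : ℂˣ) :
    complexCircleHom (sigmaPiPeriod Ψ) u = sigmaBlockDiagSL σ ℂ fun k ↦ complexCircleHom (Ψ k) u :=
  Subtype.ext (complexCircle_sigmaPiPeriod Ψ u)

/-- `diag_k(ν_k(u)) ∈ Hg(∏ₖ X_k)(ℂ)` for ONE common parameter `u` (any family; `μ(𝔾_m) ⊆ G_ℂ`).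
[cite: Deligne1982HodgeCycles, I §3 Prop. 3.4 and I §5] -/
theorem sigmaBlockDiagSL_complexCircleHom_const_mem_hodgeGroupC_sigmaPiPeriod (u : ℂˣ) :
    sigmaBlockDiagSL σ ℂ (fun k ↦ complexCircleHom (Ψ k) u) ∈ hodgeGroupC (sigmaPiPeriod Ψ) := by
  rw [← complexCircleHom_sigmaPiPeriod]
  exact complexCircleHom_mem_hodgeGroupC _ u

end Blocks

/-! ## §2 Density: partial complex circles from partial real circles -/

section Density

variable {κ : Type*} [Fintype κ] [DecidableEq κ] {σ : κ → Type*} [∀ k, Fintype (σ k)] [∀ k, DecidableEq (σ k)]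
  {F : κ → Type*} [∀ k, NormedAddCommGroup (F k)] [∀ k, NormedSpace ℂ (F k)]
  (Ψ : ∀ k, (σ k → ℝ) ≃L[ℝ] F k)

/-- The partial complex circle `diag_k(ν_k(v) if p k else 1)` is a Laurent curve `A₀ + vA₁ + v⁻¹A₂`. [cite: Lange2023AbelianVarietiesComplex, §7.2.1 Remark 7.2.2 (1) (p. 329)] -/
private theorem coe_sigmaBlockDiagSL_ite_complexCircleSL (p : κ → Prop) [DecidablePred p] {v : ℂ} (hv : v ≠ 0) :
    ((sigmaBlockDiagSL σ ℂ fun k ↦ if p k then complexCircleSL (Ψ k) v hv else 1 :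
        SpecialLinearGroup (Σ k, σ k) ℂ) : Matrix (Σ k, σ k) (Σ k, σ k) ℂ) =
      Matrix.blockDiagonal' (fun k ↦ if p k then (0 : Matrix (σ k) (σ k) ℂ) else 1) +
        v • Matrix.blockDiagonal' (fun k ↦ if p k then
          ((1 : ℂ) / 2) • (1 : Matrix (σ k) (σ k) ℂ) + (1 / (2 * I)) • (jMatrix (Ψ k)).map Complex.ofRealHom else 0) +
        v⁻¹ • Matrix.blockDiagonal' (fun k ↦ if p k then
          ((1 : ℂ) / 2) • (1 : Matrix (σ k) (σ k) ℂ) - (1 / (2 * I)) • (jMatrix (Ψ k)).map Complex.ofRealHom else 0) := by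
  rw [coe_sigmaBlockDiagSL, ← Matrix.blockDiagonal'_smul, ← Matrix.blockDiagonal'_smul, ← Matrix.blockDiagonal'_add,
    ← Matrix.blockDiagonal'_add]
  congr 1
  funext k
  simp only [Pi.add_apply, Pi.smul_apply]
  split_ifs with hk
  · rw [coe_complexCircleSL, complexCircle_eq_smul_add_smul, zero_add]
  · rw [smul_zero, smul_zero, add_zero, add_zero]
    rfl

/-- At `|v| = 1`, `v = e^{iθ}`, the partial complex circle is the partial real circle, complexified.
[cite: Lange2023AbelianVarietiesComplex, §7.2.1 (proof of Prop. 7.2.3: "`h(z) = cos θ 1_{V_ℝ} + sin θ J`")] -/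
private theorem coe_sigmaBlockDiagSL_ite_complexCircleSL_exp (p : κ → Prop) [DecidablePred p] (θ : ℝ)
    (hv : Complex.exp (θ * I) ≠ 0) :
    ((sigmaBlockDiagSL σ ℂ fun k ↦ if p k then complexCircleSL (Ψ k) (Complex.exp (θ * I)) hv else 1 :
        SpecialLinearGroup (Σ k, σ k) ℂ) : Matrix (Σ k, σ k) (Σ k, σ k) ℂ) =
      ((sigmaBlockDiagSL σ ℝ fun k ↦ if p k then hodgeCircleSL (Ψ k) θ else 1 :
        SpecialLinearGroup (Σ k, σ k) ℝ) : Matrix (Σ k, σ k) (Σ k, σ k) ℝ).map Complex.ofRealHom := by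
  rw [coe_sigmaBlockDiagSL, coe_sigmaBlockDiagSL, Matrix.blockDiagonal'_map _ _ (map_zero _)]
  congr 1
  funext k
  split_ifs with hk
  · rw [coe_complexCircleSL, coe_hodgeCircleSL, complexCircle_exp_mul_I]
  · rw [Matrix.SpecialLinearGroup.coe_one, Matrix.SpecialLinearGroup.coe_one,
      Matrix.map_one _ (map_zero Complex.ofRealHom) (map_one Complex.ofRealHom)]

/-- **DENSITY ALONG PARTIAL CIRCLES.** If the partial real circles `diag_k(h_k(e^{iθ}) if p k, else 1)` lie in
`Hg(∏ₖ X_k)(ℝ)` for every `θ`, then the partial COMPLEX circles `diag_k(ν_k(v) if p k, else 1)` lie in `Hg(∏ₖ X_k)(ℂ)`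
for every `v ∈ ℂ^×`: a rational polynomial vanishing on `h(S¹)` vanishes on `Hg(ℝ)`, hence along the Laurent curve at
the infinitely many `v` of modulus one, hence identically (the effective content of Remark 7.2.2 (1)).
[cite: Lange2023AbelianVarietiesComplex, §7.2.1 Remark 7.2.2 (1) (p. 329)] [cite: Deligne1982HodgeCycles, I §5] -/
theorem sigmaBlockDiagSL_ite_complexCircleSL_mem_hodgeGroupC_sigmaPiPeriod (p : κ → Prop) [DecidablePred p]
    (hre : ∀ θ : ℝ, sigmaBlockDiagSL σ ℝ (fun k ↦ if p k then hodgeCircleSL (Ψ k) θ else 1) ∈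
      hodgeGroup (sigmaPiPeriod Ψ)) {v : ℂ} (hv : v ≠ 0) :
    sigmaBlockDiagSL σ ℂ (fun k ↦ if p k then complexCircleSL (Ψ k) v hv else 1) ∈ hodgeGroupC (sigmaPiPeriod Ψ) := by
  rw [mem_hodgeGroupC_iff]
  intro P hP hh
  have hI : Complex.I.im ≠ 0 := by simp
  rw [coe_sigmaBlockDiagSL_ite_complexCircleSL]
  refine mem_ratZeroLocus_of_infinite _ _ _ (infinite_range_natCast_add_div hI) (fun w hw hw0 ↦ ?_) hv
  obtain ⟨θ, hθ⟩ : ∃ θ : ℝ, Complex.exp (θ * I) = w := by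
    obtain ⟨n, rfl⟩ := hw
    exact (Complex.norm_eq_one_iff _).1 (norm_natCast_add_div_natCast_add_conj hI n)
  subst hθ
  rw [← coe_sigmaBlockDiagSL_ite_complexCircleSL Ψ p hw0, coe_sigmaBlockDiagSL_ite_complexCircleSL_exp]
  exact map_ofReal_mem_ratZeroLocus_iff.2
    ((hP.mem_realPoints_iff).1 (hodgeGroup_le_realPoints (sigmaPiPeriod Ψ) hP hh (hre θ)))

/-- The same for `v ∈ ℂ^×` as a unit, with `ν_k = complexCircleHom (Ψ k)`. [cite: Lange2023AbelianVarietiesComplex, §7.2.1 Remark 7.2.2 (1) (p. 329)]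
[cite: Deligne1982HodgeCycles, I §5] -/
theorem sigmaBlockDiagSL_ite_complexCircleHom_mem_hodgeGroupC_sigmaPiPeriod (p : κ → Prop) [DecidablePred p]
    (hre : ∀ θ : ℝ, sigmaBlockDiagSL σ ℝ (fun k ↦ if p k then hodgeCircleSL (Ψ k) θ else 1) ∈
      hodgeGroup (sigmaPiPeriod Ψ)) (v : ℂˣ) :
    sigmaBlockDiagSL σ ℂ (fun k ↦ if p k then complexCircleHom (Ψ k) v else 1) ∈ hodgeGroupC (sigmaPiPeriod Ψ) :=
  sigmaBlockDiagSL_ite_complexCircleSL_mem_hodgeGroupC_sigmaPiPeriod Ψ p hre v.ne_zero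

end Density

/-! ## §3 On the locus, `⊇`: `diag_k(ν_k(u_{d(k)})) ∈ Hg(∏ₖ X_k)(ℂ)` -/

section Locus

variable {κ : Type*} [Fintype κ] [DecidableEq κ] {σ : κ → Type*} [∀ k, Fintype (σ k)] [∀ k, DecidableEq (σ k)]
  {F : κ → Type*} [∀ k, NormedAddCommGroup (F k)] [∀ k, NormedSpace ℂ (F k)] [∀ k, FiniteDimensional ℂ (F k)]
  (Ψ : ∀ k, (σ k → ℝ) ≃L[ℝ] F k) {R : Type*} [Fintype R] [DecidableEq R] {d : κ → R}

/-- ON THE LOCUS the class-partial real circles `diag_k(h_k(e^{iθ}) if d k = i, else 1)` lie in `Hg(∏ₖ X_k)(ℝ)` (g35-#1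
with the angles `θ·𝟙_{i}`). [cite: Imai1976HodgeGroups, §3 Remarks (p. 370 L31–L38)] [cite: MoonenZarhin1999LowDim, §1 and §3 Corollary] -/
theorem sigmaBlockDiagSL_ite_hodgeCircleSL_mem_hodgeGroup_sigmaPiPeriod (hg : ∀ k, 0 < finrank ℂ (F k))
    (h : ∀ k, (hodgeGroup (Ψ k) : Set (SpecialLinearGroup (σ k) ℝ)) = Set.range (hodgeCircleSL (Ψ k)))
    (hd : ∀ k l, d k = d l ↔ homRat (Ψ k) (Ψ l) ≠ ⊥) (hsurj : Surjective d) (i : R) (θ : ℝ) :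
    sigmaBlockDiagSL σ ℝ (fun k ↦ if d k = i then hodgeCircleSL (Ψ k) θ else 1) ∈ hodgeGroup (sigmaPiPeriod Ψ) := by
  have hfun : (fun k ↦ if d k = i then hodgeCircleSL (Ψ k) θ else 1) =
      fun k ↦ hodgeCircleSL (Ψ k) ((fun j ↦ if j = i then θ else (0 : ℝ)) (d k)) := by
    funext k
    simp only
    split_ifs with hk
    · rfl
    · exact (hodgeCircleSL_zero (Ψ k)).symm
  rw [hfun]
  exact sigmaBlockDiagSL_hodgeCircleSL_comp_mem_hodgeGroup_sigmaPiPeriod Ψ hg h hd hsurj fun j ↦ if j = i then θ else 0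

/-- ON THE LOCUS the class-partial complex circles `G_i(v) = diag_k(ν_k(v) if d k = i, else 1)` lie in `Hg(∏ₖ X_k)(ℂ)`.
[cite: Imai1976HodgeGroups, §3 Remarks (p. 370 L31–L38)] [cite: Lange2023AbelianVarietiesComplex, §7.2.1 Remark 7.2.2 (1)] -/
theorem sigmaBlockDiagSL_ite_complexCircleHom_mem_hodgeGroupC_sigmaPiPeriod_of_homColouring
    (hg : ∀ k, 0 < finrank ℂ (F k))
    (h : ∀ k, (hodgeGroup (Ψ k) : Set (SpecialLinearGroup (σ k) ℝ)) = Set.range (hodgeCircleSL (Ψ k)))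
    (hd : ∀ k l, d k = d l ↔ homRat (Ψ k) (Ψ l) ≠ ⊥) (hsurj : Surjective d) (i : R) (v : ℂˣ) :
    sigmaBlockDiagSL σ ℂ (fun k ↦ if d k = i then complexCircleHom (Ψ k) v else 1) ∈ hodgeGroupC (sigmaPiPeriod Ψ) :=
  sigmaBlockDiagSL_ite_complexCircleHom_mem_hodgeGroupC_sigmaPiPeriod Ψ (fun k ↦ d k = i)
    (sigmaBlockDiagSL_ite_hodgeCircleSL_mem_hodgeGroup_sigmaPiPeriod Ψ hg h hd hsurj i) v

/-- **`⊇`: `diag_k(ν_k(u_{d(k)})) ∈ Hg(∏ₖ X_k)(ℂ)` for every `u : R → ℂ^×`** (the product over the classes `i` of the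
class-partial complex circles `G_i(u_i)`). [cite: Imai1976HodgeGroups, §3 Remarks (p. 370 L31–L38)]
[cite: MoonenZarhin1999LowDim, §1 and §3 Corollary] [cite: Deligne1982HodgeCycles, I §5] -/
theorem sigmaBlockDiagSL_complexCircleHom_comp_mem_hodgeGroupC_sigmaPiPeriod (hg : ∀ k, 0 < finrank ℂ (F k))
    (h : ∀ k, (hodgeGroup (Ψ k) : Set (SpecialLinearGroup (σ k) ℝ)) = Set.range (hodgeCircleSL (Ψ k)))
    (hd : ∀ k l, d k = d l ↔ homRat (Ψ k) (Ψ l) ≠ ⊥) (hsurj : Surjective d) (u : R → ℂˣ) :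
    sigmaBlockDiagSL σ ℂ (fun k ↦ complexCircleHom (Ψ k) (u (d k))) ∈ hodgeGroupC (sigmaPiPeriod Ψ) := by
  have key : ∀ s : Finset R,
      sigmaBlockDiagSL σ ℂ (fun k ↦ if d k ∈ s then complexCircleHom (Ψ k) (u (d k)) else 1) ∈
        hodgeGroupC (sigmaPiPeriod Ψ) := by
    intro s
    induction s using Finset.induction_on with
    | empty =>
      simp only [Finset.notMem_empty, if_false]
      exact (map_one (sigmaBlockDiagSL σ ℂ)).symm ▸ Subgroup.one_mem _
    | insert i s hi ih =>
      have hmul : (fun k ↦ if d k ∈ insert i s then complexCircleHom (Ψ k) (u (d k)) else 1) =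
          (fun k ↦ if d k = i then complexCircleHom (Ψ k) (u i) else 1) *
            fun k ↦ if d k ∈ s then complexCircleHom (Ψ k) (u (d k)) else 1 := by
        funext k
        simp only [Pi.mul_apply, Finset.mem_insert]
        by_cases hk : d k = i
        · have hks : d k ∉ s := by rw [hk]; exact hi
          rw [if_pos (Or.inl hk), if_pos hk, if_neg hks, mul_one, hk]
        · rw [if_neg hk, one_mul]
          by_cases hks : d k ∈ s
          · rw [if_pos (Or.inr hks), if_pos hks]
          · rw [if_neg hks, if_neg (not_or.2 ⟨hk, hks⟩)]
      rw [hmul, map_mul]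
      exact Subgroup.mul_mem _
        (sigmaBlockDiagSL_ite_complexCircleHom_mem_hodgeGroupC_sigmaPiPeriod_of_homColouring Ψ hg h hd hsurj i (u i)) ih
  simpa only [Finset.mem_univ, if_true] using key Finset.univ

/-! ## §4 On the locus, `⊆`: the parameters are constant on `Hom`-classes -/

omit [Fintype R] [DecidableEq R] in
/-- `algebraMap ℚ ℂ` on matrices factors through the real matrices. [folklore] -/
private theorem map_algebraMap_rat_complex {m n : Type*} (f : Matrix m n ℚ) :
    f.map (algebraMap ℚ ℂ) = (f.map ((↑) : ℚ → ℝ)).map Complex.ofRealHom := by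
  ext i j
  simp

omit [Fintype κ] [DecidableEq κ] [∀ k, FiniteDimensional ℂ (F k)] in
/-- A homomorphism `f ∈ Hom_ℚ(X_k, X_l)` intertwines the complexified circles: `f · ν_k(w) = ν_l(w) · f` (`f J_k = J_l f`).
[cite: Gordon1997, 2.15 Lemma (proof)] [cite: Lange2023AbelianVarietiesComplex, §1.1.2 Prop. 1.1.6] -/
theorem map_mul_complexCircle_eq_of_mem_homRat {k l : κ} {f : Matrix (σ l) (σ k) ℚ} (hf : f ∈ homRat (Ψ k) (Ψ l))
    (w : ℂ) : f.map (algebraMap ℚ ℂ) * complexCircle (Ψ k) w = complexCircle (Ψ l) w * f.map (algebraMap ℚ ℂ) := by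
  have hJ : f.map (algebraMap ℚ ℂ) * (jMatrix (Ψ k)).map Complex.ofRealHom =
      (jMatrix (Ψ l)).map Complex.ofRealHom * f.map (algebraMap ℚ ℂ) := by
    have hreal := congrArg (fun M : Matrix (σ l) (σ k) ℝ ↦ M.map Complex.ofRealHom) ((mem_homRat_iff _ _ f).1 hf)
    simpa only [Matrix.map_mul, ← map_algebraMap_rat_complex] using hreal
  rw [complexCircle, complexCircle, Matrix.mul_add, Matrix.add_mul, Matrix.mul_smul, Matrix.smul_mul, Matrix.mul_one,
    Matrix.one_mul, Matrix.mul_smul, Matrix.smul_mul, hJ]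

omit [∀ k, FiniteDimensional ℂ (F k)] [Fintype R] [DecidableEq R] in
/-- **`⊆`, THE CLASS CONSTRAINT: `diag_k(ν_k(v_k)) ∈ Hg(∏ₖ X_k)(ℂ)` and `Hom_ℚ(X_k, X_l) ≠ 0` force `v_k = v_l`.** Gordon's
one-block endomorphism `S_{lk}(f)`, `0 ≠ f ∈ Hom_ℚ(X_k, X_l)`, is centralised by `Hg(ℂ)` (Prop. 7.2.5), so
`ν_l(v_l) f = f ν_k(v_k) = ν_l(v_k) f`, `(ν_l(w) − 1) f = 0` for `w = v_l / v_k`, and `ν_l(w) − 1 = h_ℂ(w − 1, w⁻¹ − 1)` is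
invertible unless `w = 1`. [cite: Lange2023AbelianVarietiesComplex, §7.2.2 Prop. 7.2.5] [cite: Gordon1997, 2.15 Lemma (proof)]
[cite: Imai1976HodgeGroups, §3 Remarks (p. 370 L31–L38: "the diagonal")] -/
theorem complexCircleHom_apply_eq_of_sigmaBlockDiagSL_mem_hodgeGroupC_sigmaPiPeriod {v : κ → ℂˣ}
    (hv : sigmaBlockDiagSL σ ℂ (fun k ↦ complexCircleHom (Ψ k) (v k)) ∈ hodgeGroupC (sigmaPiPeriod Ψ)) {k l : κ}
    (hkl : homRat (Ψ k) (Ψ l) ≠ ⊥) : v k = v l := by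
  obtain ⟨f, hf, hf0⟩ := Submodule.exists_mem_ne_zero_of_ne_bot hkl
  -- `Hg(ℂ)` centralises the one-block endomorphism `S_{lk}(f)`
  have hA := sigmaBlockSingle_mem_endAlgRat_sigmaPi Ψ hf
  have hcomm := (mem_ratZeroLocus_centralizerEqs_iff (sigmaBlockSingle l k f) _).1
    (((isRatAlgSubgroupEqs_centralizerEqs (sigmaBlockSingle l k f)).mem_complexPoints_iff).1
      (hodgeGroupC_le_complexPoints (sigmaPiPeriod Ψ) (isRatAlgSubgroupEqs_centralizerEqs (sigmaBlockSingle l k f))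
        (hodgeCircle_mem_ratZeroLocus_centralizerEqs _ hA) hv))
  rw [sigmaBlockSingle_map l k f (map_zero _), coe_sigmaBlockDiagSL] at hcomm
  -- block `(l, k)`: `ν_l(v_l) f = f ν_k(v_k) = ν_l(v_k) f`
  have hblock := congrArg (fun X ↦ sigmaBlock X l k) hcomm
  rw [sigmaBlock_mul_sigmaBlockSingle_same, sigmaBlock_blockDiagonal'_same, sigmaBlock_sigmaBlockSingle_mul_same,
    sigmaBlock_blockDiagonal'_same, coe_complexCircleHom, coe_complexCircleHom,
    map_mul_complexCircle_eq_of_mem_homRat Ψ hf] at hblock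
  -- `ν_l(w) f = f` for `w = v_l v_k⁻¹`
  set fC : Matrix (σ l) (σ k) ℂ := f.map (algebraMap ℚ ℂ) with hfC
  have hfC0 : fC ≠ 0 := fun h0 ↦ hf0 (Matrix.map_injective (algebraMap ℚ ℂ).injective
    (h0.trans (Matrix.map_zero _ (map_zero (algebraMap ℚ ℂ))).symm))
  have hw : complexCircle (Ψ l) ((v l : ℂ) * (v k : ℂ)⁻¹) * fC = fC := by
    rw [mul_comm (v l : ℂ), complexCircle_mul, Matrix.mul_assoc, hblock, ← Matrix.mul_assoc, ← complexCircle_mul,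
      inv_mul_cancel₀ (v k).ne_zero, complexCircle_one, Matrix.one_mul]
  by_contra hne
  have hw1 : (v l : ℂ) * (v k : ℂ)⁻¹ ≠ 1 := fun h1 ↦ hne (Units.val_injective ((mul_inv_eq_one₀ (v k).ne_zero).1 h1)).symm
  have hz : (v l : ℂ) * (v k : ℂ)⁻¹ - 1 ≠ 0 := sub_ne_zero.2 hw1
  have hz' : ((v l : ℂ) * (v k : ℂ)⁻¹)⁻¹ - 1 ≠ 0 := sub_ne_zero.2 fun h1 ↦ hw1 (inv_eq_one.1 h1)
  -- `ν_l(w) - 1 = h_ℂ(w - 1, w⁻¹ - 1)` is invertible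
  have hsub : (complexCircle (Ψ l) ((v l : ℂ) * (v k : ℂ)⁻¹) - 1) * fC = 0 := by
    rw [Matrix.sub_mul, Matrix.one_mul, hw, sub_self]
  rw [← hodgeSC_inv, ← hodgeSC_one_one (Ψ l), hodgeSC_sub_hodgeSC] at hsub
  have hinv := hodgeSC_mul_hodgeSC_inv (Ψ l) (inv_ne_zero hz) (inv_ne_zero hz')
  rw [inv_inv, inv_inv] at hinv
  apply hfC0
  calc fC = (hodgeSC (Ψ l) ((v l : ℂ) * (v k : ℂ)⁻¹ - 1)⁻¹ (((v l : ℂ) * (v k : ℂ)⁻¹)⁻¹ - 1)⁻¹ *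
        hodgeSC (Ψ l) ((v l : ℂ) * (v k : ℂ)⁻¹ - 1) (((v l : ℂ) * (v k : ℂ)⁻¹)⁻¹ - 1)) * fC := by
          rw [hinv, Matrix.one_mul]
    _ = 0 := by rw [Matrix.mul_assoc, hsub, Matrix.mul_zero]

omit [Fintype κ] [DecidableEq κ] [∀ k, DecidableEq (σ k)] [Fintype R] [DecidableEq R] in
/-- Positive-dimensional factors have non-empty index types (`|σ k| = 2 dim X_k`). [folklore] -/
private theorem nonempty_index_of_finrank_pos_sigmaC (Ψ : ∀ k, (σ k → ℝ) ≃L[ℝ] F k) (hg : ∀ k, 0 < finrank ℂ (F k))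
    (k : κ) : Nonempty (σ k) := by
  rw [← Fintype.card_pos_iff, card_eq_two_mul_finrank (Ψ k)]
  exact Nat.mul_pos two_pos (hg k)

/-- **THE THEOREM (ℂ-points of `Hg` of a product of locus tori).** For positive-dimensional tori `X_k` on the
Hodge-circle locus with a `Hom`-colouring `d : κ → R` (`d k = d l ⟺ Hom_ℚ(X_k, X_l) ≠ 0`, `d` onto):
**`M ∈ Hg(∏ₖ X_k)(ℂ) ⟺ M = diag_k(ν_k(u_{d(k)}))` for some `u ∈ (ℂ^×)^R`** — the split torus `𝔾_m(ℂ)^R`, the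
complexification of g35-#1's class-diagonal `U(1)^R = Hg(∏ₖ X_k)(ℝ)` (Imai's `Δ_{m₁}(Hg(E₁)) × ⋯ × Δ_{m_k}(Hg(E_k))` on
complex points). [cite: Imai1976HodgeGroups, §3 Remarks (p. 370 L31–L38)] [cite: MoonenZarhin1999LowDim, §1, §2 (2.2) and §3 Corollary]
[cite: Deligne1982HodgeCycles, I §5] [cite: Gordon1997, §3 Theorem] -/
theorem mem_hodgeGroupC_sigmaPiPeriod_iff_exists_of_homColouring (hg : ∀ k, 0 < finrank ℂ (F k))
    (h : ∀ k, (hodgeGroup (Ψ k) : Set (SpecialLinearGroup (σ k) ℝ)) = Set.range (hodgeCircleSL (Ψ k)))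
    (hd : ∀ k l, d k = d l ↔ homRat (Ψ k) (Ψ l) ≠ ⊥) (hsurj : Surjective d) {M : SpecialLinearGroup (Σ k, σ k) ℂ} :
    M ∈ hodgeGroupC (sigmaPiPeriod Ψ) ↔
      ∃ u : R → ℂˣ, M = sigmaBlockDiagSL σ ℂ fun k ↦ complexCircleHom (Ψ k) (u (d k)) := by
  haveI : ∀ k, Nonempty (σ k) := nonempty_index_of_finrank_pos_sigmaC Ψ hg
  constructor
  · intro hM
    obtain ⟨N, hN, rfl⟩ := exists_eq_sigmaBlockDiagSL_of_mem_hodgeGroupC_sigmaPi Ψ hM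
    have hex : ∀ k, ∃ v : ℂˣ, complexCircleHom (Ψ k) v = N k := fun k ↦
      (mem_hodgeGroupC_iff_exists_complexCircleHom_of_coe_hodgeGroup_eq_range (Ψ k) (h k)).1 (hN k)
    choose v hv using hex
    have hNv : N = fun k ↦ complexCircleHom (Ψ k) (v k) := funext fun k ↦ (hv k).symm
    subst hNv
    choose s hs using hsurj
    refine ⟨fun i ↦ v (s i), congrArg (sigmaBlockDiagSL σ ℂ) (funext fun k ↦ ?_)⟩
    rw [complexCircleHom_apply_eq_of_sigmaBlockDiagSL_mem_hodgeGroupC_sigmaPiPeriod Ψ hM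
      ((hd k (s (d k))).1 (hs (d k)).symm)]
  · rintro ⟨u, rfl⟩
    exact sigmaBlockDiagSL_complexCircleHom_comp_mem_hodgeGroupC_sigmaPiPeriod Ψ hg h hd hsurj u

/-- **`Hg(∏ₖ X_k)(ℂ) = {diag_k(ν_k(u_{d(k)})) : u ∈ (ℂ^×)^R}`** as sets. [cite: Imai1976HodgeGroups, §3 Remarks (p. 370 L31–L38)]
[cite: MoonenZarhin1999LowDim, §1 and §3 Corollary] -/
theorem coe_hodgeGroupC_sigmaPiPeriod_eq_range_of_homColouring (hg : ∀ k, 0 < finrank ℂ (F k))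
    (h : ∀ k, (hodgeGroup (Ψ k) : Set (SpecialLinearGroup (σ k) ℝ)) = Set.range (hodgeCircleSL (Ψ k)))
    (hd : ∀ k l, d k = d l ↔ homRat (Ψ k) (Ψ l) ≠ ⊥) (hsurj : Surjective d) :
    (hodgeGroupC (sigmaPiPeriod Ψ) : Set (SpecialLinearGroup (Σ k, σ k) ℂ)) =
      Set.range (fun u : R → ℂˣ ↦ sigmaBlockDiagSL σ ℂ fun k ↦ complexCircleHom (Ψ k) (u (d k))) := by
  ext M
  rw [SetLike.mem_coe, mem_hodgeGroupC_sigmaPiPeriod_iff_exists_of_homColouring Ψ hg h hd hsurj, Set.mem_range]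
  exact ⟨fun ⟨u, hu⟩ ↦ ⟨u, hu.symm⟩, fun ⟨u, hu⟩ ↦ ⟨u, hu.symm⟩⟩

omit [Fintype R] [DecidableEq R] in
/-- **COLOURING-FREE FORM: `M ∈ Hg(∏ₖ X_k)(ℂ) ⟺ M = diag_k(ν_k(v_k))` with `v_k = v_l` whenever `Hom_ℚ(X_k, X_l) ≠ 0`.**
[cite: Imai1976HodgeGroups, §3 Remarks (p. 370 L31–L38)] [cite: MoonenZarhin1999LowDim, (0.2)(4) and §3 Corollary]
[cite: Deligne1982HodgeCycles, I §5] -/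
theorem mem_hodgeGroupC_sigmaPiPeriod_iff_exists_of_coe_eq_range (hg : ∀ k, 0 < finrank ℂ (F k))
    (h : ∀ k, (hodgeGroup (Ψ k) : Set (SpecialLinearGroup (σ k) ℝ)) = Set.range (hodgeCircleSL (Ψ k)))
    {M : SpecialLinearGroup (Σ k, σ k) ℂ} :
    M ∈ hodgeGroupC (sigmaPiPeriod Ψ) ↔ ∃ v : κ → ℂˣ, (∀ k l, homRat (Ψ k) (Ψ l) ≠ ⊥ → v k = v l) ∧
      M = sigmaBlockDiagSL σ ℂ fun k ↦ complexCircleHom (Ψ k) (v k) := by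
  obtain ⟨r, d, -, hsurj, hd⟩ := exists_homColouring_of_coe_eq_range Ψ hg h
  rw [mem_hodgeGroupC_sigmaPiPeriod_iff_exists_of_homColouring Ψ hg h hd hsurj]
  constructor
  · rintro ⟨u, rfl⟩
    exact ⟨fun k ↦ u (d k), fun k l hkl ↦ by show u (d k) = u (d l); rw [(hd k l).2 hkl], rfl⟩
  · rintro ⟨v, hv, rfl⟩
    choose s hs using hsurj
    refine ⟨fun i ↦ v (s i), congrArg (sigmaBlockDiagSL σ ℂ) (funext fun k ↦ ?_)⟩
    rw [hv k (s (d k)) ((hd k (s (d k))).1 (hs (d k)).symm)]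

omit [Fintype R] [DecidableEq R] in
/-- **`diag_k(ν_k(v_k)) ∈ Hg(∏ₖ X_k)(ℂ) ⟺ v_k = v_l` whenever `Hom_ℚ(X_k, X_l) ≠ 0`** ("the diagonal `Δ_{m_i}`" on complex
points). [cite: Imai1976HodgeGroups, §3 Remarks (p. 370 L31–L38)] [cite: MoonenZarhin1999LowDim, §1 and §3 Corollary] -/
theorem sigmaBlockDiagSL_complexCircleHom_mem_hodgeGroupC_sigmaPiPeriod_iff (hg : ∀ k, 0 < finrank ℂ (F k))
    (h : ∀ k, (hodgeGroup (Ψ k) : Set (SpecialLinearGroup (σ k) ℝ)) = Set.range (hodgeCircleSL (Ψ k))) (v : κ → ℂˣ) :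
    sigmaBlockDiagSL σ ℂ (fun k ↦ complexCircleHom (Ψ k) (v k)) ∈ hodgeGroupC (sigmaPiPeriod Ψ) ↔
      ∀ k l, homRat (Ψ k) (Ψ l) ≠ ⊥ → v k = v l := by
  refine ⟨fun hv k l hkl ↦ complexCircleHom_apply_eq_of_sigmaBlockDiagSL_mem_hodgeGroupC_sigmaPiPeriod Ψ hv hkl,
    fun hv ↦ ?_⟩
  exact (mem_hodgeGroupC_sigmaPiPeriod_iff_exists_of_coe_eq_range Ψ hg h).2 ⟨v, hv, rfl⟩

end Locus

end ComplexTorus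

end Literature.Geometry.Kaehler

end
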